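import Mathlib
import Literature.ModelTheory.ExponentialFields.CylindricalDecompositionProofs
import Literature.ModelTheory.ExponentialFields.SemialgebraicC1TriangulationProofs
import Literature.ModelTheory.ExponentialFields.SemialgebraicInterior
import Literature.ModelTheory.ExponentialFields.TarskiSeidenbergProofs
import Literature.NumberTheory.Transcendental.SemialgebraicMaps
import HarnessLib

/-!
# SoloInformed — continuous roots of rational polynomials are `ℚ`-semialgebraic

**THEOREM (Nash selection over `ℚ`).** Let `W ⊆ ℝⁿ` be open and `ℚ`-semialgebraic, `G : ℝⁿ → ℝ`
continuous on `W`, and `P ∈ ℚ[z₁, …, zₙ, T]`, `P ≠ 0`, with `P(x, G x) = 0` for all `x ∈ W`.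
Then `G` is a `ℚ`-semialgebraic function on `W`
(`soloInformed_isSemialgebraicFunOn_of_aeval_eq_zero`).

This is the input "LEMMA Q" of the Ayoub transfer (`SoloInformedAyoubTransfer.lean`): the real
restriction of a power series algebraic over `ℚ(z)` is a legitimate integrand of the
Kontsevich–Zagier calculus. [Bochnak–Coste–Roy 1998, Prop. 8.1.8 is the version over `ℝ` for Nash
functions; the point here is the field of definition `ℚ` and that continuity suffices.]

Proof. Let `V = {P = 0} ⊆ ℝⁿ⁺¹` and `Z = {x | P(x, ·) ≡ 0}` (both `ℚ`-semialgebraic, `Z` by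
Tarski–Seidenberg; `V` and hence `Z` have empty interior since `P ≠ 0`). Take a cylindrical
decomposition of `ℝⁿ⁺¹` over `ℚ` adapted to `V` and to the cylinders over `Z` and `W`
[Basu–Pollack–Roy 2006, Cor. 5.7, proved in the tree]. A base cell meeting `W ∖ Z` lies in `W ∖ Z`;
over such a cell `S` the point `(x, G x) ∈ V` lies on a graph-cell (a band-cell inside `V` would put
`x` in `Z`, by the identity principle in the last variable), so `G x = ξ_{S,j(x)}(x)`, and `j(x)` is
constant on the connected cell `S` by continuity. Hence the graph of `G` over `W ∖ Z` is a finite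
union of cells, and the graph over `W` is its closure inside the cylinder over `W` (continuity of
`G`, density of `W ∖ Z` in `W`); closures of `ℚ`-semialgebraic sets are `ℚ`-semialgebraic.
-/

noncomputable section

open Set Filter Topology
open Literature.ModelTheory.ExponentialFields
open Literature.ModelTheory.ExponentialFields.CylindricalDecomposition (exists_mem_band)
open Literature.NumberTheory.Transcendental (IsSemialgebraicFunOn isSemialgebraicFunOn_iff)

namespace Summit.KontsevichZagierPeriods.KontsevichZagierPeriods.Theorems

variable {n : ℕ}

/-! ### The zero set and the degeneracy locus of `P` -/

/-- The real zero set `V(P) ⊆ ℝⁿ⁺¹` of `P ∈ ℚ[z₀, …, zₙ]`. -/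
def soloInformedZeroSet (P : MvPolynomial (Fin (n + 1)) ℚ) : Set (Fin (n + 1) → ℝ) :=
  {z | MvPolynomial.aeval z P = 0}

/-- The degeneracy locus `Z(P) ⊆ ℝⁿ`: base points over which `P(x, ·)` vanishes identically. -/
def soloInformedDegenerate (P : MvPolynomial (Fin (n + 1)) ℚ) : Set (Fin n → ℝ) :=
  {x | ∀ t : ℝ, (Fin.snoc x t : Fin (n + 1) → ℝ) ∈ soloInformedZeroSet P}

/-- Membership in the zero set (definitional). -/
@[simp] theorem mem_soloInformedZeroSet {P : MvPolynomial (Fin (n + 1)) ℚ} {z : Fin (n + 1) → ℝ} :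
    z ∈ soloInformedZeroSet P ↔ MvPolynomial.aeval z P = 0 := Iff.rfl

/-- The zero set is `ℚ`-semialgebraic. -/
theorem isSemialgebraic_soloInformedZeroSet (P : MvPolynomial (Fin (n + 1)) ℚ) :
    IsSemialgebraic ℚ (soloInformedZeroSet P) :=
  isSemialgebraic_setOf_eval_eq_zero P

/-- The complement of the degeneracy locus is the projection of the complement of the zero set. -/
theorem compl_soloInformedDegenerate_eq (P : MvPolynomial (Fin (n + 1)) ℚ) :
    (soloInformedDegenerate P)ᶜ =
      (fun z : Fin (n + 1) → ℝ => z ∘ Fin.castSucc) '' (soloInformedZeroSet P)ᶜ := by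
  ext x
  simp only [mem_compl_iff, soloInformedDegenerate, mem_setOf_eq, not_forall, mem_image]
  constructor
  · rintro ⟨t, ht⟩
    exact ⟨Fin.snoc x t, ht, funext fun i => by simp⟩
  · rintro ⟨z, hz, rfl⟩
    refine ⟨z (Fin.last n), ?_⟩
    have : (Fin.snoc (z ∘ Fin.castSucc) (z (Fin.last n)) : Fin (n + 1) → ℝ) = z :=
      Fin.snoc_init_self z
    rwa [this]

/-- The degeneracy locus is `ℚ`-semialgebraic (Tarski–Seidenberg). -/
theorem isSemialgebraic_soloInformedDegenerate (P : MvPolynomial (Fin (n + 1)) ℚ) :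
    IsSemialgebraic ℚ (soloInformedDegenerate P) := by
  have h := tarski_seidenberg_real_holds (k := ℚ) (isSemialgebraic_soloInformedZeroSet P).compl
  rw [← compl_soloInformedDegenerate_eq] at h
  simpa using h.compl

/-- A non-zero rational polynomial does not vanish at every real point. -/
theorem soloInformed_exists_aeval_ne_zero {P : MvPolynomial (Fin (n + 1)) ℚ} (hP : P ≠ 0) :
    ∃ z : Fin (n + 1) → ℝ, MvPolynomial.aeval z P ≠ 0 := by
  by_contra h
  simp only [not_exists, not_not] at h
  apply hP
  apply MvPolynomial.map_injective (algebraMap ℚ ℝ) (algebraMap ℚ ℝ).injective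
  rw [map_zero]
  exact MvPolynomial.funext fun z => by
    rw [MvPolynomial.eval_map, ← MvPolynomial.aeval_def, h z, map_zero]

/-- The zero set of a non-zero polynomial has empty interior. -/
theorem interior_soloInformedZeroSet {P : MvPolynomial (Fin (n + 1)) ℚ} (hP : P ≠ 0) :
    interior (soloInformedZeroSet P) = ∅ :=
  interior_setOf_aeval_eq_zero P (soloInformed_exists_aeval_ne_zero hP)

/-- The degeneracy locus of a non-zero polynomial has empty interior. -/
theorem interior_soloInformedDegenerate {P : MvPolynomial (Fin (n + 1)) ℚ} (hP : P ≠ 0) :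
    interior (soloInformedDegenerate P) = ∅ := by
  by_contra hne
  obtain ⟨x, hx⟩ := nonempty_iff_ne_empty.2 hne
  have hsub : {z : Fin (n + 1) → ℝ | Fin.init z ∈ interior (soloInformedDegenerate P)} ⊆
      soloInformedZeroSet P := fun z hz => by
    have h := interior_subset (s := soloInformedDegenerate P) hz (z (Fin.last n))
    rwa [Fin.snoc_init_self] at h
  have hopen : IsOpen {z : Fin (n + 1) → ℝ | Fin.init z ∈ interior (soloInformedDegenerate P)} :=
    isOpen_interior.preimage (continuous_pi fun i => continuous_apply (Fin.castSucc i))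
  have hmem : (Fin.snoc x 0 : Fin (n + 1) → ℝ) ∈ interior (soloInformedZeroSet P) :=
    interior_maximal hsub hopen (by simpa using hx)
  rw [interior_soloInformedZeroSet hP] at hmem
  exact hmem

/-- An open set lies in the closure of its part off the degeneracy locus. -/
theorem soloInformed_subset_closure_diff {P : MvPolynomial (Fin (n + 1)) ℚ} (hP : P ≠ 0)
    {W : Set (Fin n → ℝ)} (hWo : IsOpen W) : W ⊆ closure (W \ soloInformedDegenerate P) := by
  have hd : Dense (soloInformedDegenerate P)ᶜ :=
    interior_eq_empty_iff_dense_compl.1 (interior_soloInformedDegenerate hP)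
  intro x hx
  exact hd.open_subset_closure_inter hWo hx

/-- `t ↦ P(x, t)` is real-analytic. -/
theorem soloInformed_analyticOnNhd_snoc (P : MvPolynomial (Fin (n + 1)) ℚ) (x : Fin n → ℝ) :
    AnalyticOnNhd ℝ (fun t : ℝ => MvPolynomial.aeval (Fin.snoc x t : Fin (n + 1) → ℝ) P) univ := by
  refine AnalyticOnNhd.aeval_mvPolynomial
    (f := fun (t : ℝ) (i : Fin (n + 1)) => (Fin.snoc x t : Fin (n + 1) → ℝ) i) (fun i => ?_) P
  refine Fin.lastCases ?_ (fun j => ?_) i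
  · simp only [Fin.snoc_last]
    exact analyticOnNhd_id
  · simp only [Fin.snoc_castSucc]
    exact analyticOnNhd_const

/-- **Identity principle in the last variable**: if a whole band over `x` lies in `V(P)` then
`P(x, ·) ≡ 0`, i.e. `x ∈ Z(P)`. -/
theorem soloInformed_mem_degenerate_of_band_subset {P : MvPolynomial (Fin (n + 1)) ℚ} {l : ℕ}
    {S : Set (Fin n → ℝ)} {ξ : Fin l → (Fin n → ℝ) → ℝ} {j : Fin (l + 1)} {x : Fin n → ℝ}
    (hmono : StrictMono fun i => ξ i x) (hxS : x ∈ S)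
    (hsub : bandOver S ξ j ⊆ soloInformedZeroSet P) : x ∈ soloInformedDegenerate P := by
  obtain ⟨t₀, ht₀⟩ := exists_mem_band ξ x hmono j
  have hO : IsOpen ((fun t : ℝ => (t : EReal)) ⁻¹' Ioo (bandLower ξ j x) (bandUpper ξ j x)) :=
    isOpen_Ioo.preimage continuous_coe_real_ereal
  have hev : (fun t : ℝ => MvPolynomial.aeval (Fin.snoc x t : Fin (n + 1) → ℝ) P) =ᶠ[𝓝 t₀] 0 := by
    filter_upwards [hO.mem_nhds ht₀] with t ht
    exact hsub (snoc_mem_bandOver_iff.2 ⟨hxS, ht.1, ht.2⟩)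
  intro t
  exact (soloInformed_analyticOnNhd_snoc P x).eqOn_zero_of_preconnected_of_eventuallyEq_zero
    isPreconnected_univ (mem_univ t₀) hev (mem_univ t)

/-! ### Cells of an adapted cylindrical decomposition -/

section Stack

variable {𝒮 : Finset (Set (Fin n → ℝ))} {𝒯 : Finset (Set (Fin (n + 1) → ℝ))}
  {l : Set (Fin n → ℝ) → ℕ} {ξ : (S : Set (Fin n → ℝ)) → Fin (l S) → (Fin n → ℝ) → ℝ}

/-- If the cylinder over `A` is a union of cells of the stack `𝒯` over `𝒮`, then every base cell
meeting `A` lies in `A`. -/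
theorem soloInformed_subset_of_cylinder
    (hmem : ∀ T, T ∈ 𝒯 ↔ ∃ S ∈ 𝒮, (∃ j, T = graphOver S (ξ S j)) ∨ ∃ j, T = bandOver S (ξ S) j)
    (hpart : Setoid.IsPartition (𝒮 : Set (Set (Fin n → ℝ))))
    (hmono : ∀ S ∈ 𝒮, ∀ x ∈ S, StrictMono fun j => ξ S j x)
    {A : Set (Fin n → ℝ)} {𝒞 : Finset (Set (Fin (n + 1) → ℝ))} (h𝒞 : 𝒞 ⊆ 𝒯)
    (hA : ⋃₀ (𝒞 : Set (Set (Fin (n + 1) → ℝ))) = {z : Fin (n + 1) → ℝ | Fin.init z ∈ A})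
    {S : Set (Fin n → ℝ)} (hS : S ∈ 𝒮) {x₀ : Fin n → ℝ} (hx₀ : x₀ ∈ S) (hx₀A : x₀ ∈ A) :
    S ⊆ A := by
  have hz₀ : (Fin.snoc x₀ (0 : ℝ) : Fin (n + 1) → ℝ) ∈ ⋃₀ (𝒞 : Set (Set (Fin (n + 1) → ℝ))) := by
    rw [hA]; simpa using hx₀A
  obtain ⟨T₀, hT₀𝒞, hzT₀⟩ := mem_sUnion.1 hz₀
  obtain ⟨S', hS', hT₀⟩ := (hmem T₀).1 (h𝒞 hT₀𝒞)
  have hx₀S' : x₀ ∈ S' := by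
    rcases hT₀ with ⟨j, rfl⟩ | ⟨j, rfl⟩
    · exact (snoc_mem_graphOver_iff.1 hzT₀).1
    · exact (snoc_mem_bandOver_iff.1 hzT₀).1
  obtain rfl : S' = S := (hpart.2 x₀).unique ⟨hS', hx₀S'⟩ ⟨hS, hx₀⟩
  intro x hx
  obtain ⟨z, hzT, hzx⟩ : ∃ z ∈ T₀, Fin.init z = x := by
    rcases hT₀ with ⟨j, rfl⟩ | ⟨j, rfl⟩
    · exact ⟨Fin.snoc x (ξ S' j x), snoc_mem_graphOver_iff.2 ⟨hx, rfl⟩, Fin.init_snoc _ _⟩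
    · obtain ⟨t, ht⟩ := exists_mem_band (ξ S') x (hmono S' hS' x hx) j
      exact ⟨Fin.snoc x t, snoc_mem_bandOver_iff.2 ⟨hx, ht.1, ht.2⟩, Fin.init_snoc _ _⟩
  have hz : z ∈ {z : Fin (n + 1) → ℝ | Fin.init z ∈ A} := by
    rw [← hA]; exact mem_sUnion.2 ⟨T₀, hT₀𝒞, hzT⟩
  simpa [hzx] using hz

/-- Over a base cell off `Z(P)`, a value `G x` with `(x, G x) ∈ V(P)` is one of the sections (the
cell of the adapted decomposition through `(x, G x)` cannot be a band). -/
theorem soloInformed_exists_eq_section {P : MvPolynomial (Fin (n + 1)) ℚ}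
    (hmem : ∀ T, T ∈ 𝒯 ↔ ∃ S ∈ 𝒮, (∃ j, T = graphOver S (ξ S j)) ∨ ∃ j, T = bandOver S (ξ S) j)
    (hpart : Setoid.IsPartition (𝒮 : Set (Set (Fin n → ℝ))))
    (hmono : ∀ S ∈ 𝒮, ∀ x ∈ S, StrictMono fun j => ξ S j x)
    {𝒞 : Finset (Set (Fin (n + 1) → ℝ))} (h𝒞 : 𝒞 ⊆ 𝒯)
    (hV : ⋃₀ (𝒞 : Set (Set (Fin (n + 1) → ℝ))) = soloInformedZeroSet P)
    {S : Set (Fin n → ℝ)} (hS : S ∈ 𝒮) (hSZ : Disjoint S (soloInformedDegenerate P))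
    {x : Fin n → ℝ} (hx : x ∈ S) {y : ℝ}
    (hy : (Fin.snoc x y : Fin (n + 1) → ℝ) ∈ soloInformedZeroSet P) :
    ∃ j : Fin (l S), y = ξ S j x := by
  rw [← hV] at hy
  obtain ⟨T, hT𝒞, hzT⟩ := mem_sUnion.1 hy
  obtain ⟨S', hS', hT⟩ := (hmem T).1 (h𝒞 hT𝒞)
  have hxS' : x ∈ S' := by
    rcases hT with ⟨j, rfl⟩ | ⟨j, rfl⟩
    · exact (snoc_mem_graphOver_iff.1 hzT).1
    · exact (snoc_mem_bandOver_iff.1 hzT).1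
  obtain rfl : S' = S := (hpart.2 x).unique ⟨hS', hxS'⟩ ⟨hS, hx⟩
  rcases hT with ⟨j, rfl⟩ | ⟨j, rfl⟩
  · exact ⟨j, (snoc_mem_graphOver_iff.1 hzT).2⟩
  · exfalso
    have hTV : bandOver S' (ξ S') j ⊆ soloInformedZeroSet P := by
      rw [← hV]; exact subset_sUnion_of_mem hT𝒞
    exact hSZ.le_bot ⟨hx, soloInformed_mem_degenerate_of_band_subset (hmono S' hS' x hx) hx hTV⟩

/-- On a connected base cell `S ⊆ W` off `Z(P)`, a continuous root `G` of `P(x, G x) = 0` is ONE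
section `ξ_{S,j}` (the index is locally constant by continuity, hence constant). -/
theorem soloInformed_exists_forall_eq_section {P : MvPolynomial (Fin (n + 1)) ℚ}
    (hmem : ∀ T, T ∈ 𝒯 ↔ ∃ S ∈ 𝒮, (∃ j, T = graphOver S (ξ S j)) ∨ ∃ j, T = bandOver S (ξ S) j)
    (hpart : Setoid.IsPartition (𝒮 : Set (Set (Fin n → ℝ))))
    (hcont : ∀ S ∈ 𝒮, ∀ j, ContinuousOn (ξ S j) S)
    (hmono : ∀ S ∈ 𝒮, ∀ x ∈ S, StrictMono fun j => ξ S j x)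
    {𝒞 : Finset (Set (Fin (n + 1) → ℝ))} (h𝒞 : 𝒞 ⊆ 𝒯)
    (hV : ⋃₀ (𝒞 : Set (Set (Fin (n + 1) → ℝ))) = soloInformedZeroSet P)
    {S : Set (Fin n → ℝ)} (hS : S ∈ 𝒮) (hSc : IsPreconnected S)
    (hSZ : Disjoint S (soloInformedDegenerate P))
    {W : Set (Fin n → ℝ)} (hSW : S ⊆ W) {G : (Fin n → ℝ) → ℝ} (hG : ContinuousOn G W)
    (hPG : ∀ x ∈ W, (Fin.snoc x (G x) : Fin (n + 1) → ℝ) ∈ soloInformedZeroSet P)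
    {x₀ : Fin n → ℝ} (hx₀ : x₀ ∈ S) :
    ∃ j : Fin (l S), ∀ x ∈ S, G x = ξ S j x := by
  classical
  have hsec : ∀ x ∈ S, ∃ j : Fin (l S), G x = ξ S j x := fun x hx =>
    soloInformed_exists_eq_section hmem hpart hmono h𝒞 hV hS hSZ hx (hPG x (hSW hx))
  choose jx hjx using hsec
  have j₀ : Fin (l S) := jx x₀ hx₀
  let φ : (Fin n → ℝ) → Fin (l S) := fun x => if hx : x ∈ S then jx x hx else j₀
  have hφ : ∀ x ∈ S, G x = ξ S (φ x) x := fun x hx => by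
    simp only [φ, dif_pos hx]; exact hjx x hx
  have hφc : ContinuousOn φ S := by
    intro x₁ hx₁
    have hev : ∀ᶠ x in 𝓝[S] x₁, ∀ i : Fin (l S), i ≠ φ x₁ → G x ≠ ξ S i x := by
      refine eventually_all.2 fun i => ?_
      by_cases hi : i = φ x₁
      · exact Eventually.of_forall fun x h => (h hi).elim
      · have hne : G x₁ - ξ S i x₁ ≠ 0 := by
          rw [hφ x₁ hx₁, sub_ne_zero]
          exact fun h => hi ((hmono S hS x₁ hx₁).injective h).symm
        have hc : ContinuousWithinAt (fun x => G x - ξ S i x) S x₁ :=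
          ((hG.mono hSW) x₁ hx₁).sub (hcont S hS i x₁ hx₁)
        filter_upwards [hc.eventually_mem (isOpen_ne.mem_nhds hne)] with x hx h
        exact fun hGx => hx (sub_eq_zero.2 hGx)
    have hev' : φ =ᶠ[𝓝[S] x₁] fun _ => φ x₁ := by
      filter_upwards [hev, self_mem_nhdsWithin] with x hx hxS
      by_contra hne
      exact hx (φ x) hne (hφ x hxS)
    exact (continuousWithinAt_const (b := φ x₁)).congr_of_eventuallyEq hev' rfl
  refine ⟨φ x₀, fun x hx => ?_⟩
  rw [hφ x hx, hSc.constant hφc hx hx₀]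

end Stack

/-! ### The theorem -/

/-- The graph of `G` over `W ∖ Z(P)` is `ℚ`-semialgebraic: it is the union of the cells of an
adapted cylindrical decomposition that it contains. -/
theorem soloInformed_isSemialgebraic_graph_diff {P : MvPolynomial (Fin (n + 1)) ℚ}
    {W : Set (Fin n → ℝ)} (hWs : IsSemialgebraic ℚ W) {G : (Fin n → ℝ) → ℝ} (hG : ContinuousOn G W)
    (hPG : ∀ x ∈ W, MvPolynomial.aeval (Fin.snoc x (G x) : Fin (n + 1) → ℝ) P = 0) :
    IsSemialgebraic ℚ {z : Fin (n + 1) → ℝ |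
      ∃ x ∈ W \ soloInformedDegenerate P, z = Fin.snoc x (G x)} := by
  classical
  set Z := soloInformedDegenerate P with hZ
  set Γ₀ := {z : Fin (n + 1) → ℝ | ∃ x ∈ W \ Z, z = Fin.snoc x (G x)} with hΓ₀
  have hcylZ : IsSemialgebraic ℚ {z : Fin (n + 1) → ℝ | Fin.init z ∈ Z} :=
    (isSemialgebraic_soloInformedDegenerate P).setOf_init_mem
  have hcylW : IsSemialgebraic ℚ {z : Fin (n + 1) → ℝ | Fin.init z ∈ W} := hWs.setOf_init_mem
  obtain ⟨𝒯, h𝒯, hF⟩ := IsSemialgebraic.exists_cylindricalDecomposition_holds (k := ℚ)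
    ({soloInformedZeroSet P, {z : Fin (n + 1) → ℝ | Fin.init z ∈ Z},
        {z : Fin (n + 1) → ℝ | Fin.init z ∈ W}} : Finset (Set (Fin (n + 1) → ℝ)))
    (by
      intro s hs
      simp only [Finset.mem_insert, Finset.mem_singleton] at hs
      rcases hs with rfl | rfl | rfl
      · exact isSemialgebraic_soloInformedZeroSet P
      · exact hcylZ
      · exact hcylW)
  obtain ⟨𝒞V, h𝒞V, hV⟩ := hF (soloInformedZeroSet P) (by simp)
  obtain ⟨𝒞Z, h𝒞Z, hZc⟩ := hF {z : Fin (n + 1) → ℝ | Fin.init z ∈ Z} (by simp)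
  obtain ⟨𝒞W, h𝒞W, hWc⟩ := hF {z : Fin (n + 1) → ℝ | Fin.init z ∈ W} (by simp)
  obtain ⟨𝒮, h𝒮, l, ξ, hcont, -, hmono, hmem⟩ := h𝒯.2.2
  have hpart := h𝒮.isPartition
  -- the graph over `W ∖ Z` is the union of the cells it contains
  have hΓ : Γ₀ = ⋃ T ∈ 𝒯.filter (fun T => T ⊆ Γ₀), T := by
    refine Subset.antisymm (fun z hz => ?_) ?_
    · obtain ⟨x, ⟨hxW, hxZ⟩, rfl⟩ := hz
      obtain ⟨S, ⟨hS, hxS⟩, -⟩ := hpart.2 x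
      have hSW : S ⊆ W := soloInformed_subset_of_cylinder hmem hpart hmono h𝒞W hWc hS hxS hxW
      have hSZ : Disjoint S Z := by
        refine disjoint_left.2 fun x' hx'S hx'Z => hxZ ?_
        exact soloInformed_subset_of_cylinder hmem hpart hmono h𝒞Z hZc hS hx'S hx'Z hxS
      obtain ⟨j, hj⟩ := soloInformed_exists_forall_eq_section hmem hpart hcont hmono h𝒞V hV hS
        (h𝒮.isPreconnected_of_mem S hS) hSZ hSW hG (fun x hx => hPG x hx) hxS
      have hT : graphOver S (ξ S j) ∈ 𝒯 := (hmem _).2 ⟨S, hS, Or.inl ⟨j, rfl⟩⟩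
      have hTΓ : graphOver S (ξ S j) ⊆ Γ₀ := by
        intro z' hz'
        refine ⟨Fin.init z', ⟨hSW hz'.1, fun h => hSZ.le_bot ⟨hz'.1, h⟩⟩, ?_⟩
        rw [hj _ hz'.1, ← hz'.2, Fin.snoc_init_self]
      refine mem_iUnion₂.2 ⟨graphOver S (ξ S j), Finset.mem_filter.2 ⟨hT, hTΓ⟩, ?_⟩
      exact snoc_mem_graphOver_iff.2 ⟨hxS, hj x hxS⟩
    · exact iUnion₂_subset fun T hT => (Finset.mem_filter.1 hT).2
  rw [hΓ]
  exact IsSemialgebraic.biUnion _ _ fun T hT => h𝒯.2.1 T (Finset.mem_filter.1 hT).1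

/-- **Nash selection over `ℚ`.** A continuous function on an open `ℚ`-semialgebraic set which is a
root of a non-zero polynomial with rational coefficients is a `ℚ`-semialgebraic function.
[Bochnak–Coste–Roy 1998, Prop. 8.1.8 (over `ℝ`); the `ℚ`-structure is the point here] -/
theorem soloInformed_isSemialgebraicFunOn_of_aeval_eq_zero {P : MvPolynomial (Fin (n + 1)) ℚ}
    (hP : P ≠ 0) {W : Set (Fin n → ℝ)} (hWo : IsOpen W) (hWs : IsSemialgebraic ℚ W)
    {G : (Fin n → ℝ) → ℝ} (hG : ContinuousOn G W)
    (hPG : ∀ x ∈ W, MvPolynomial.aeval (Fin.snoc x (G x) : Fin (n + 1) → ℝ) P = 0) :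
    IsSemialgebraicFunOn ℚ W G := by
  set Z := soloInformedDegenerate P with hZ
  set Γ₀ := {z : Fin (n + 1) → ℝ | ∃ x ∈ W \ Z, z = Fin.snoc x (G x)} with hΓ₀
  have h0 : IsSemialgebraic ℚ Γ₀ := soloInformed_isSemialgebraic_graph_diff hWs hG hPG
  rw [isSemialgebraicFunOn_iff]
  -- the graph over `W` is the closure of `Γ₀` inside the cylinder over `W`
  have hΓ : {z : Fin (n + 1) → ℝ | Fin.init z ∈ W ∧ z (Fin.last n) = G (Fin.init z)} =
      closure Γ₀ ∩ {z | Fin.init z ∈ W} := by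
    refine Subset.antisymm (fun z hz => ⟨?_, hz.1⟩) (fun z hz => ⟨hz.2, ?_⟩)
    · -- `(x, G x)` is a limit of graph points over `W ∖ Z`
      have hx : Fin.init z ∈ closure (W \ Z) := soloInformed_subset_closure_diff hP hWo hz.1
      have hc : ContinuousWithinAt (fun x => (Fin.snoc x (G x) : Fin (n + 1) → ℝ)) (W \ Z)
          (Fin.init z) :=
        ((continuousOn_snoc_apply hG) _ hz.1).mono fun _ h => h.1
      have himg : (fun x => (Fin.snoc x (G x) : Fin (n + 1) → ℝ)) '' (W \ Z) = Γ₀ := by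
        ext z'
        simp only [mem_image, hΓ₀, mem_setOf_eq]
        constructor
        · rintro ⟨x, hx', rfl⟩; exact ⟨x, hx', rfl⟩
        · rintro ⟨x, hx', rfl⟩; exact ⟨x, hx', rfl⟩
      have hzeq : (Fin.snoc (Fin.init z) (G (Fin.init z)) : Fin (n + 1) → ℝ) = z := by
        rw [← hz.2, Fin.snoc_init_self]
      have h := hc.mem_closure_image hx
      rwa [himg, hzeq] at h
    · -- the graph relation is closed inside the open cylinder
      have hWo' : IsOpen {z : Fin (n + 1) → ℝ | Fin.init z ∈ W} :=
        hWo.preimage (continuous_pi fun i => continuous_apply (Fin.castSucc i))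
      have hH : ContinuousOn (fun z : Fin (n + 1) → ℝ => z (Fin.last n) - G (Fin.init z))
          {z | Fin.init z ∈ W} :=
        (continuous_apply (Fin.last n)).continuousOn.sub
          (hG.comp (continuous_pi fun i => continuous_apply (Fin.castSucc i)).continuousOn
            fun z hz => hz)
      have hc : ContinuousWithinAt (fun z : Fin (n + 1) → ℝ => z (Fin.last n) - G (Fin.init z))
          Γ₀ z :=
        (hH.continuousAt (hWo'.mem_nhds hz.2)).continuousWithinAt
      have himg : (fun z : Fin (n + 1) → ℝ => z (Fin.last n) - G (Fin.init z)) '' Γ₀ ⊆ {0} := by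
        rintro _ ⟨z', ⟨x, -, rfl⟩, rfl⟩
        simp
      have h0 : z (Fin.last n) - G (Fin.init z) ∈ closure ({0} : Set ℝ) :=
        closure_mono himg (hc.mem_closure_image hz.1)
      rw [closure_singleton, mem_singleton_iff, sub_eq_zero] at h0
      exact h0
  rw [hΓ]
  exact (isSemialgebraic_closure h0).inter hWs.setOf_init_mem

end Summit.KontsevichZagierPeriods.KontsevichZagierPeriods.Theorems
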